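import Summits.Ventures.HodgeRepro2.T5HeckeAdjoint
import Summits.Ventures.HodgeRepro2.T5HeckeMatrixCoefficient

/-!
# Hecke operators are adjoint under `T ↦ T^∨` for an invariant bilinear form

Let `B : V → V → k` be a `G`-invariant bilinear form on a representation `π` (`B(π(g)v, π(g)w) =
B(v, w)`; for a unitary representation, the invariant hermitian form).  For `K`-fixed `v, w` and
`T ∈ H(G, K)`,

  `B(T • v, w) = B(v, transposeOp T • w)`

(`apply_heckeSMul_eq_apply_heckeSMul_transposeOp`), provided `#(Kg⁻¹K/K) = #(KgK/K)` for all `g`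
(the counting form of unimodularity, `T5HaarDoubleCosetInverse`).  In particular the double-coset
operator `T_g` and `T_{g⁻¹}` are adjoint — the printed «`T_g^* = T_{g⁻¹}` on `π^K` for unitary
`π`».  Proof: both sides are linear in `T`; on the basis `T_g`, `T5HeckeMatrixCoefficient` gives
`#(KgK/K) · B(π(g)v, w)` on the left and `#(Kg⁻¹K/K) · B(v, π(g⁻¹)w) = #(Kg⁻¹K/K) · B(π(g)v, w)`
on the right.
-/

namespace Summit.Ventures.HodgeRepro2.T5HeckeAdjointForm

open T5HeckePermutationModule T5HeckeDoubleCoset T5HeckeDoubleCosetBasis T5HeckeConvolution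
  T5HeckeTranspose T5HeckeMatrixCoefficient LevelPositivity

variable {G : Type*} [Group G] {k : Type*} [Field k] {V : Type*} [AddCommGroup V] [Module k V]
  (ρ : Representation k G V) {K : Subgroup G}

/-- A `G`-invariant bilinear form: `B(π(g)v, π(g)w) = B(v, w)`. -/
def IsInvariantForm (B : V →ₗ[k] V →ₗ[k] k) : Prop :=
  ∀ (g : G) (v w : V), B (ρ g v) (ρ g w) = B v w

variable {ρ}

/-- For an invariant form and `K`-fixed `w`, the functional `v ↦ B(v, w)` is `K`-fixed in the
dual representation. -/
theorem flip_mem_invariants_dual {B : V →ₗ[k] V →ₗ[k] k} (hB : IsInvariantForm ρ B) {w : V}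
    (hw : w ∈ invariants ρ K) : B.flip w ∈ invariants ρ.dual K := by
  rw [mem_invariants_iff]
  intro κ hκ
  ext u
  rw [Representation.dual_apply, Module.Dual.transpose_apply, LinearMap.comp_apply,
    LinearMap.flip_apply, LinearMap.flip_apply]
  conv_rhs => rw [← hB κ⁻¹ u w]
  rw [mem_invariants_iff.1 hw κ⁻¹ (K.inv_mem hκ)]

/-- For an invariant form and `K`-fixed `v`, the functional `w ↦ B(v, w)` is `K`-fixed in the
dual representation. -/
theorem apply_mem_invariants_dual {B : V →ₗ[k] V →ₗ[k] k} (hB : IsInvariantForm ρ B) {v : V}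
    (hv : v ∈ invariants ρ K) : B v ∈ invariants ρ.dual K := by
  rw [mem_invariants_iff]
  intro κ hκ
  ext u
  rw [Representation.dual_apply, Module.Dual.transpose_apply, LinearMap.comp_apply]
  conv_rhs => rw [← hB κ⁻¹ v u]
  rw [mem_invariants_iff.1 hv κ⁻¹ (K.inv_mem hκ)]

/-- `T ↦ B(T • v, w)` is `k`-linear on `H(G, K)`. -/
noncomputable def pairLeft (B : V →ₗ[k] V →ₗ[k] k) (v : invariants ρ K) (w : V) :
    heckeAlgebra k K →ₗ[k] k where
  toFun T := B (heckeSMul ρ T v) w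
  map_add' T T' := by
    rw [heckeSMul_add_left, Submodule.coe_add, map_add, LinearMap.add_apply]
  map_smul' c T := by
    rw [heckeSMul_smul_left, Submodule.coe_smul, map_smul, LinearMap.smul_apply, RingHom.id_apply]

/-- `T ↦ B(v, transposeOp T • w)` is `k`-linear on `H(G, K)`. -/
noncomputable def pairRight (hK : ∀ g : G, Finite (MulAction.orbit K (g : G ⧸ K)))
    (B : V →ₗ[k] V →ₗ[k] k) (v : V) (w : invariants ρ K) : heckeAlgebra k K →ₗ[k] k where
  toFun T := B v (heckeSMul ρ (transposeOp hK T) w)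
  map_add' T T' := by
    rw [transposeOp_add, heckeSMul_add_left, Submodule.coe_add, map_add]
  map_smul' c T := by
    rw [transposeOp_smul, heckeSMul_smul_left, Submodule.coe_smul, map_smul, RingHom.id_apply]

/-- THE ADJOINT IDENTITY ON A DOUBLE COSET: `B(T_g • v, w) = B(v, T_{g⁻¹} • w)` when
`#(Kg⁻¹K/K) = #(KgK/K)`. -/
theorem apply_heckeSMul_doubleCosetOp_eq (hK : ∀ g : G, Finite (MulAction.orbit K (g : G ⧸ K)))
    {B : V →ₗ[k] V →ₗ[k] k} (hB : IsInvariantForm ρ B) (g : G)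
    [Finite (MulAction.orbit K (g : G ⧸ K))]
    (hU : (MulAction.orbit K ((g⁻¹ : G) : G ⧸ K)).ncard = (MulAction.orbit K (g : G ⧸ K)).ncard)
    (v w : invariants ρ K) :
    pairLeft B v w (doubleCosetOp k K g) = pairRight hK B v w (doubleCosetOp k K g) := by
  haveI := hK g⁻¹
  show B (heckeSMul ρ (doubleCosetOp k K g) v) w =
    B v (heckeSMul ρ (transposeOp hK (doubleCosetOp k K g)) w)
  have h₁ := apply_heckeSMul_doubleCosetOp ρ (flip_mem_invariants_dual hB w.2) g v
  have h₂ := apply_heckeSMul_doubleCosetOp ρ (apply_mem_invariants_dual hB v.2) g⁻¹ w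
  rw [LinearMap.flip_apply, LinearMap.flip_apply] at h₁
  rw [h₁, transposeOp_doubleCosetOp, h₂, hU]
  congr 1
  conv_rhs => rw [← hB g v (ρ g⁻¹ w)]
  rw [← Module.End.mul_apply, ← map_mul, mul_inv_cancel, map_one, Module.End.one_apply]

/-- HECKE OPERATORS ARE ADJOINT UNDER `T ↦ transposeOp T` FOR AN INVARIANT FORM: for `K`-fixed
`v, w` and every `T ∈ H(G, K)`, `B(T • v, w) = B(v, transposeOp T • w)`, provided
`#(Kg⁻¹K/K) = #(KgK/K)` for all `g`. -/
theorem apply_heckeSMul_eq_apply_heckeSMul_transposeOp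
    (hK : ∀ g : G, Finite (MulAction.orbit K (g : G ⧸ K)))
    (hU : ∀ g : G, (MulAction.orbit K ((g⁻¹ : G) : G ⧸ K)).ncard =
      (MulAction.orbit K (g : G ⧸ K)).ncard)
    {B : V →ₗ[k] V →ₗ[k] k} (hB : IsInvariantForm ρ B) (T : heckeAlgebra k K)
    (v w : invariants ρ K) :
    B (heckeSMul ρ T v) w = B v (heckeSMul ρ (transposeOp hK T) w) := by
  have h : pairLeft B v (w : V) = pairRight hK B (v : V) w := by
    apply Module.Basis.ext (heckeAlgebraBasis k K)
    intro ω
    rw [T5HeckeAdjoint.heckeAlgebraBasis_eq_doubleCosetOp]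
    haveI := T5HeckeAdjoint.finite_orbit_out_out ω
    exact apply_heckeSMul_doubleCosetOp_eq hK hB _ (hU _) v w
  exact LinearMap.congr_fun h T

/-- The double-coset operators `T_g` and `T_{g⁻¹}` are adjoint for an invariant form. -/
theorem apply_heckeSMul_doubleCosetOp_eq_apply_heckeSMul_doubleCosetOp_inv
    (hK : ∀ g : G, Finite (MulAction.orbit K (g : G ⧸ K)))
    {B : V →ₗ[k] V →ₗ[k] k} (hB : IsInvariantForm ρ B) (g : G)
    [Finite (MulAction.orbit K (g : G ⧸ K))] [Finite (MulAction.orbit K ((g⁻¹ : G) : G ⧸ K))]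
    (hU : (MulAction.orbit K ((g⁻¹ : G) : G ⧸ K)).ncard = (MulAction.orbit K (g : G ⧸ K)).ncard)
    (v w : invariants ρ K) :
    B (heckeSMul ρ (doubleCosetOp k K g) v) w = B v (heckeSMul ρ (doubleCosetOp k K g⁻¹) w) := by
  have h := apply_heckeSMul_doubleCosetOp_eq hK hB g hU v w
  rw [show pairLeft B v (w : V) (doubleCosetOp k K g) = B (heckeSMul ρ (doubleCosetOp k K g) v) w
    from rfl, show pairRight hK B (v : V) w (doubleCosetOp k K g) =
      B v (heckeSMul ρ (transposeOp hK (doubleCosetOp k K g)) w) from rfl,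
    transposeOp_doubleCosetOp] at h
  exact h

end Summit.Ventures.HodgeRepro2.T5HeckeAdjointForm
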